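import Mathlib
import HarnessLib
import Literature.Computability.AlgebraicComplexity.PatternExpressions
import Literature.Combinatorics.SimpleGraph.TreeDecomposition
import Summits.ValiantsHypothesis.ValiantsHypothesis.Theorems.MonotoneRestorationOrbitRestorationQPHomSpan
import Summits.ValiantsHypothesis.ValiantsHypothesis.Theorems.MonotoneRestorationOrbitCompressionQPDiHomSpanTools

/-!
# Route MonotoneRestoration, derived node `NonnegRestorationQP` (stmt-16191) / aside `OrbitCompressionQP`
# (stmt-18332) — THE ONE-SORTED → TWO-SORTED PASSAGE WITH A VERTEX BUDGET: a matrix-symmetric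
# polynomial with a DIRECTED expansion over patterns on `≤ m` vertices has a BIPARTITE expansion over
# patterns with `≤ m` vertices a side (treewidth `< 2m`)

Helper file (`--supports stmt-ValiantsHypothesis-16191`), def-free.  The compression line of
`OrbitCompressionQP` (= `stub_orbitCompression` of `Cruxes/NonnegRestorationQP/Lines/orbit_cut.lean`, line
`Cruxes/OrbitCompressionQP/Lines/expression_compression`) needs, after the refutation of its registered
first stub (`Theorems/…OrbitToNarrowExpressionFalse.lean`: square-symmetric circuits compute
square-symmetric, not matrix-symmetric, values — the trace), an extra step recorded there as a caveat: from
the ONE-SORTED currency in which square-symmetric circuits live (directed looped homomorphism polynomials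
`dihom_{E,n} = Σ_{h : Fin a → Fin n} Π_{(u,v) ∈ E} x_{h u, h v}`, `Theorems/…DiHomSpan.lean`) to the
TWO-SORTED currency of the route's narrow expansions (bipartite `hom_{F,n}`, K1 of line `narrow-expansion`).
Narrowness by TREEWIDTH does not transfer in general (the Reynolds projection folds patterns, and quotients
raise treewidth), but narrowness by NUMBER OF VERTICES — which is what supports of size `m` produce — does:

* `orbitSum_mem_span_homPoly₃`, `mem_span_homPoly_of_rows_cols_le` — REFINED SPANNING THEOREM: a
  matrix-symmetric polynomial all of whose monomials use `≤ r` rows and `≤ s` columns lies in the span of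
  the `hom_{F,n}` with `≤ r` row vertices, `≤ s` column vertices and `≤ deg` edges (the induction of
  `HomSpan.orbitSum_mem_span_homPoly` with three separate budgets);
* `rows_cols_le_of_mem_support_diHom` — monomials of `dihom_{E,n}`, `E` on `Fin a`, use `≤ a` rows and
  `≤ a` columns; `rows_cols_le_of_mem_support_reynolds` — and so do those of its Reynolds sum over
  `Sym_n × Sym_n`;
* `mem_span_homPoly_of_mem_span_diHom` — THE PASSAGE: a MATRIX-symmetric `p` in the span of the
  `dihom_{E,n}` with `E` on `≤ m` vertices lies in the span of the `hom_{F,n}` with `F` on `≤ m + m`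
  vertices (`≤ m` a side) — apply the Reynolds operator of `Sym_n × Sym_n`, which fixes `p`, is linear, and
  maps each `dihom_{E,n}` to a matrix-symmetric polynomial whose monomials use `≤ m` rows and columns;
* `mem_narrowSpan_of_mem_span_diHom` — hence `p` lies in the span of `hom_{F,n}` over patterns of
  treewidth `≤ 2m - 1` (K1's currency, `treewidth_le_card_sub_one`).

So in the SUPPORT regime (square-symmetric circuits with supports of size `m = polylog`, Dawar–Wilsenach)
the one-sorted→two-sorted step of the repaired compression stub costs a factor `2` in the width and nothing
else.  Honest label: algebra helper for a line stub's repair; no stub closed; VP ≠ VNP not moved.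
[cite: DwivediPagoSeppelt2026, §8 (Lemma 8.18)] [cite: DawarPagoSeppelt2025, Remark p. 17 and §8 p. 45]
-/

-- `Summit.ValiantsHypothesis.ValiantsHypothesis.…` is the tree's mandated namespace (Sub = Summit).
set_option linter.dupNamespace false

noncomputable section

namespace Summit.ValiantsHypothesis.ValiantsHypothesis.Theorems

namespace TwoSortedPassage

open Literature.Computability.AlgebraicComplexity MvPolynomial HomSpan

variable {n : ℕ}

/-! ### The refined spanning theorem (three budgets) -/

/-- Transport with three budgets: the homomorphism polynomial of a pattern on finite vertex types `A, B`
is one of a pattern on `Fin a × Fin b` with `a = |A|`, `b = |B|` and the same number of edges. [folklore] -/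
theorem homPoly_mem_homSet₃ {A B : Type} [Fintype A] [DecidableEq A] [Fintype B] [DecidableEq B]
    (E : Multiset (A × B)) (n r s d : ℕ) (hA : Fintype.card A ≤ r) (hB : Fintype.card B ≤ s)
    (hE : Multiset.card E ≤ d) :
    homPoly E n ℂ ∈ {q : MvPolynomial (Fin n × Fin n) ℂ | ∃ (a b : ℕ) (E' : Multiset (Fin a × Fin b)),
      a ≤ r ∧ b ≤ s ∧ Multiset.card E' ≤ d ∧ q = homPoly E' n ℂ} := by
  refine ⟨Fintype.card A, Fintype.card B,
    E.map fun e => (Fintype.equivFin A e.1, Fintype.equivFin B e.2), hA, hB, by simpa using hE, ?_⟩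
  rw [HomPolyBasics.homPoly_map_equiv]

/-- **Orbit sums lie in the span of homomorphism polynomials — three budgets.**  The orbit sum of an
exponent `D` using `≤ r` rows, `≤ s` columns and of degree `≤ d` lies in the span of the `hom_{F,n}` with
`≤ r` row vertices, `≤ s` column vertices and `≤ d` edges (the induction of
`HomSpan.orbitSum_mem_span_homPoly`, bookkeeping refined). [cite: DwivediPagoSeppelt2026, §8] -/
theorem orbitSum_mem_span_homPoly₃ (r s d : ℕ) :
    ∀ (ν : ℕ) (D : (Fin n × Fin n) →₀ ℕ),
      (D.support.image Prod.fst).card + (D.support.image Prod.snd).card = ν →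
      (D.support.image Prod.fst).card ≤ r → (D.support.image Prod.snd).card ≤ s →
      Multiset.card (Finsupp.toMultiset D) ≤ d →
      (∑ g : Equiv.Perm (Fin n) × Equiv.Perm (Fin n),
          monomial (D.mapDomain fun ij : Fin n × Fin n => (g.1 ij.1, g.2 ij.2)) (1 : ℂ)) ∈
        Submodule.span ℂ {q : MvPolynomial (Fin n × Fin n) ℂ | ∃ (a b : ℕ) (E : Multiset (Fin a × Fin b)),
          a ≤ r ∧ b ≤ s ∧ Multiset.card E ≤ d ∧ q = homPoly E n ℂ} := by
  classical
  intro ν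
  induction ν using Nat.strong_induction_on with
  | _ ν ih =>
  intro D hν hr hs hd
  obtain ⟨A, B, iA, dA, iB, dB, E, h₀, hEA, hEB, h₁, h₂, hD, hcA, hcB, hcE⟩ := exists_presentation D
  set I : Finset ((A → Fin n) × (B → Fin n)) :=
    Finset.univ.filter fun h => Function.Injective h.1 ∧ Function.Injective h.2 with hI
  have h₀I : h₀ ∈ I := Finset.mem_filter.2 ⟨Finset.mem_univ _, h₁, h₂⟩
  have hR := card_smul_homPoly_eq_sum_orbitSum E n
  rw [← Finset.sum_filter_add_sum_filter_not Finset.univ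
    (fun h : (A → Fin n) × (B → Fin n) => Function.Injective h.1 ∧ Function.Injective h.2)] at hR
  have hinj : ∑ h ∈ I, ∑ g : Equiv.Perm (Fin n) × Equiv.Perm (Fin n),
      monomial ((Multiset.toFinsupp (E.map fun e => (h.1 e.1, h.2 e.2))).mapDomain
        fun ij : Fin n × Fin n => (g.1 ij.1, g.2 ij.2)) (1 : ℂ) =
      (I.card : ℂ) • ∑ g : Equiv.Perm (Fin n) × Equiv.Perm (Fin n),
        monomial (D.mapDomain fun ij : Fin n × Fin n => (g.1 ij.1, g.2 ij.2)) (1 : ℂ) := by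
    rw [Finset.sum_congr rfl fun h hh => ?_, Finset.sum_const, ← Nat.cast_smul_eq_nsmul ℂ]
    obtain ⟨-, hh1, hh2⟩ := Finset.mem_filter.1 hh
    rw [orbitSum_push_eq_of_injective E h₀ h h₁ h₂ hh1 hh2, hD]
  have hnon : ∀ h ∈ Finset.univ.filter (fun h : (A → Fin n) × (B → Fin n) =>
      ¬ (Function.Injective h.1 ∧ Function.Injective h.2)),
      (∑ g : Equiv.Perm (Fin n) × Equiv.Perm (Fin n),
        monomial ((Multiset.toFinsupp (E.map fun e => (h.1 e.1, h.2 e.2))).mapDomain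
          fun ij : Fin n × Fin n => (g.1 ij.1, g.2 ij.2)) (1 : ℂ)) ∈
        Submodule.span ℂ {q : MvPolynomial (Fin n × Fin n) ℂ | ∃ (a b : ℕ) (E : Multiset (Fin a × Fin b)),
          a ≤ r ∧ b ≤ s ∧ Multiset.card E ≤ d ∧ q = homPoly E n ℂ} := by
    intro h hh
    obtain ⟨-, hh⟩ := Finset.mem_filter.1 hh
    have le1 : (Finset.univ.image h.1).card ≤ Fintype.card A := Finset.card_image_le.trans (by simp)
    have le2 : (Finset.univ.image h.2).card ≤ Fintype.card B := Finset.card_image_le.trans (by simp)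
    have hrA : Fintype.card A ≤ r := hcA ▸ hr
    have hsB : Fintype.card B ≤ s := hcB ▸ hs
    refine ih _ ?_ _ rfl ?_ ?_ (by rw [card_toMultiset_push, hcE]; exact hd)
    · rw [← hν, support_push_image_fst E hEA, support_push_image_snd E hEB, ← hcA, ← hcB]
      rcases not_and_or.1 hh with hn1 | hn2
      · have lt1 : (Finset.univ.image h.1).card < Fintype.card A := by
          refine lt_of_le_of_ne le1 fun heq => hn1 ?_
          have := Finset.injOn_of_card_image_eq (s := Finset.univ) (f := h.1)
            (by rw [Finset.card_univ]; exact heq)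
          simpa [Set.injOn_univ] using this
        omega
      · have lt2 : (Finset.univ.image h.2).card < Fintype.card B := by
          refine lt_of_le_of_ne le2 fun heq => hn2 ?_
          have := Finset.injOn_of_card_image_eq (s := Finset.univ) (f := h.2)
            (by rw [Finset.card_univ]; exact heq)
          simpa [Set.injOn_univ] using this
        omega
    · rw [support_push_image_fst E hEA]; exact le1.trans hrA
    · rw [support_push_image_snd E hEB]; exact le2.trans hsB
  have hhom : homPoly E n ℂ ∈ Submodule.span ℂ {q : MvPolynomial (Fin n × Fin n) ℂ |
      ∃ (a b : ℕ) (E : Multiset (Fin a × Fin b)),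
        a ≤ r ∧ b ≤ s ∧ Multiset.card E ≤ d ∧ q = homPoly E n ℂ} :=
    Submodule.subset_span (homPoly_mem_homSet₃ E n r s d (hcA ▸ hr) (hcB ▸ hs) (hcE ▸ hd))
  have hIne : (I.card : ℂ) ≠ 0 := Nat.cast_ne_zero.2 (Finset.card_ne_zero.2 ⟨h₀, h₀I⟩)
  rw [hinj] at hR
  have hsolve : (∑ g : Equiv.Perm (Fin n) × Equiv.Perm (Fin n),
      monomial (D.mapDomain fun ij : Fin n × Fin n => (g.1 ij.1, g.2 ij.2)) (1 : ℂ)) =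
      (I.card : ℂ)⁻¹ • ((Fintype.card (Equiv.Perm (Fin n) × Equiv.Perm (Fin n)) : ℂ) • homPoly E n ℂ -
        ∑ h ∈ Finset.univ.filter (fun h : (A → Fin n) × (B → Fin n) =>
            ¬ (Function.Injective h.1 ∧ Function.Injective h.2)),
          ∑ g : Equiv.Perm (Fin n) × Equiv.Perm (Fin n),
            monomial ((Multiset.toFinsupp (E.map fun e => (h.1 e.1, h.2 e.2))).mapDomain
              fun ij : Fin n × Fin n => (g.1 ij.1, g.2 ij.2)) (1 : ℂ)) := by
    rw [hR, add_sub_cancel_right, smul_smul, inv_mul_cancel₀ hIne, one_smul]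
  rw [hsolve]
  exact Submodule.smul_mem _ _ (Submodule.sub_mem _ (Submodule.smul_mem _ _ hhom)
    (Submodule.sum_mem _ hnon))

/-- **Refined spanning theorem.**  A matrix-symmetric polynomial all of whose monomials use `≤ r` rows and
`≤ s` columns lies in the span of the `hom_{F,n}` with `≤ r` row vertices, `≤ s` column vertices and
`≤ deg p` edges. [cite: DwivediPagoSeppelt2026, §8] -/
theorem mem_span_homPoly_of_rows_cols_le (p : MvPolynomial (Fin n × Fin n) ℂ)
    (hp : ∀ σ τ : Equiv.Perm (Fin n), rename (fun ij : Fin n × Fin n => (σ ij.1, τ ij.2)) p = p)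
    {r s : ℕ} (hr : ∀ D ∈ p.support, (D.support.image Prod.fst).card ≤ r)
    (hs : ∀ D ∈ p.support, (D.support.image Prod.snd).card ≤ s) :
    p ∈ Submodule.span ℂ {q : MvPolynomial (Fin n × Fin n) ℂ | ∃ (a b : ℕ) (E : Multiset (Fin a × Fin b)),
      a ≤ r ∧ b ≤ s ∧ Multiset.card E ≤ p.totalDegree ∧ q = homPoly E n ℂ} := by
  classical
  have hG : (Fintype.card (Equiv.Perm (Fin n) × Equiv.Perm (Fin n)) : ℂ) ≠ 0 :=
    Nat.cast_ne_zero.2 Fintype.card_ne_zero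
  have key := card_smul_eq_sum_orbitSum p hp
  have hmem : (Fintype.card (Equiv.Perm (Fin n) × Equiv.Perm (Fin n)) : ℂ) • p ∈
      Submodule.span ℂ {q : MvPolynomial (Fin n × Fin n) ℂ | ∃ (a b : ℕ) (E : Multiset (Fin a × Fin b)),
        a ≤ r ∧ b ≤ s ∧ Multiset.card E ≤ p.totalDegree ∧ q = homPoly E n ℂ} := by
    rw [key]
    refine Submodule.sum_mem _ fun D hD => Submodule.smul_mem _ _
      (orbitSum_mem_span_homPoly₃ r s p.totalDegree _ D rfl (hr D hD) (hs D hD) ?_)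
    rw [Finsupp.card_toMultiset]
    exact le_totalDegree hD
  have := Submodule.smul_mem _ ((Fintype.card (Equiv.Perm (Fin n) × Equiv.Perm (Fin n)) : ℂ)⁻¹) hmem
  rwa [smul_smul, inv_mul_cancel₀ hG, one_smul] at this

/-! ### Rows and columns used by directed homomorphism polynomials and their Reynolds sums -/

/-- **Monomials of `dihom_{E,n}`, `E` on `Fin a`, use `≤ a` rows and `≤ a` columns.** [folklore] -/
theorem rows_cols_le_of_mem_support_diHom {a : ℕ} (E : Multiset (Fin a × Fin a))
    {D : (Fin n × Fin n) →₀ ℕ}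
    (hD : D ∈ (∑ h : Fin a → Fin n,
      (E.map fun e => (X (h e.1, h e.2) : MvPolynomial (Fin n × Fin n) ℂ)).prod).support) :
    (D.support.image Prod.fst).card ≤ a ∧ (D.support.image Prod.snd).card ≤ a := by
  classical
  rw [DiHomSpan.diHom_eq_sum_monomial] at hD
  obtain ⟨h, -, hh⟩ := Finset.mem_biUnion.1 (support_sum hD)
  have hDe : D = Multiset.toFinsupp (E.map fun e => (h e.1, h e.2)) := by
    have := support_monomial_subset hh
    simpa using this
  have hsub : D.support ⊆ Finset.univ.image fun uv : Fin a × Fin a => (h uv.1, h uv.2) := by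
    intro ij hij
    rw [hDe, Multiset.toFinsupp_support, Multiset.mem_toFinset, Multiset.mem_map] at hij
    obtain ⟨e, -, rfl⟩ := hij
    exact Finset.mem_image.2 ⟨e, Finset.mem_univ _, rfl⟩
  constructor
  · calc (D.support.image Prod.fst).card
        ≤ ((Finset.univ.image fun uv : Fin a × Fin a => (h uv.1, h uv.2)).image Prod.fst).card :=
          Finset.card_le_card (Finset.image_subset_image hsub)
      _ ≤ (Finset.univ.image h).card := by
          refine Finset.card_le_card fun i hi => ?_
          simp only [Finset.mem_image, Finset.mem_univ, true_and] at hi ⊢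
          obtain ⟨_, ⟨uv, rfl⟩, rfl⟩ := hi
          exact ⟨uv.1, rfl⟩
      _ ≤ a := Finset.card_image_le.trans (by simp)
  · calc (D.support.image Prod.snd).card
        ≤ ((Finset.univ.image fun uv : Fin a × Fin a => (h uv.1, h uv.2)).image Prod.snd).card :=
          Finset.card_le_card (Finset.image_subset_image hsub)
      _ ≤ (Finset.univ.image h).card := by
          refine Finset.card_le_card fun i hi => ?_
          simp only [Finset.mem_image, Finset.mem_univ, true_and] at hi ⊢
          obtain ⟨_, ⟨uv, rfl⟩, rfl⟩ := hi
          exact ⟨uv.2, rfl⟩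
      _ ≤ a := Finset.card_image_le.trans (by simp)

/-- Renaming by a pair of permutations does not increase the numbers of rows and columns a monomial
uses. [folklore] -/
theorem rows_cols_le_of_mem_support_rename (q : MvPolynomial (Fin n × Fin n) ℂ)
    (g : Equiv.Perm (Fin n) × Equiv.Perm (Fin n)) {r s : ℕ}
    (hr : ∀ D ∈ q.support, (D.support.image Prod.fst).card ≤ r)
    (hs : ∀ D ∈ q.support, (D.support.image Prod.snd).card ≤ s)
    {D : (Fin n × Fin n) →₀ ℕ}
    (hD : D ∈ (rename (fun ij : Fin n × Fin n => (g.1 ij.1, g.2 ij.2)) q).support) :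
    (D.support.image Prod.fst).card ≤ r ∧ (D.support.image Prod.snd).card ≤ s := by
  classical
  have hinj : Function.Injective fun ij : Fin n × Fin n => (g.1 ij.1, g.2 ij.2) := by
    intro ij ij' h
    simp only [Prod.mk.injEq, EmbeddingLike.apply_eq_iff_eq] at h
    exact Prod.ext h.1 h.2
  rw [support_rename_of_injective hinj, Finset.mem_image] at hD
  obtain ⟨D₀, hD₀, rfl⟩ := hD
  have hsub := Finsupp.mapDomain_support (f := fun ij : Fin n × Fin n => (g.1 ij.1, g.2 ij.2)) (s := D₀)
  constructor
  · calc ((Finsupp.mapDomain (fun ij : Fin n × Fin n => (g.1 ij.1, g.2 ij.2)) D₀).support.image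
          Prod.fst).card
        ≤ ((D₀.support.image fun ij : Fin n × Fin n => (g.1 ij.1, g.2 ij.2)).image Prod.fst).card :=
          Finset.card_le_card (Finset.image_subset_image hsub)
      _ = ((D₀.support.image Prod.fst).image g.1).card := by rw [Finset.image_image, Finset.image_image]; rfl
      _ ≤ r := Finset.card_image_le.trans (hr D₀ hD₀)
  · calc ((Finsupp.mapDomain (fun ij : Fin n × Fin n => (g.1 ij.1, g.2 ij.2)) D₀).support.image
          Prod.snd).card
        ≤ ((D₀.support.image fun ij : Fin n × Fin n => (g.1 ij.1, g.2 ij.2)).image Prod.snd).card :=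
          Finset.card_le_card (Finset.image_subset_image hsub)
      _ = ((D₀.support.image Prod.snd).image g.2).card := by rw [Finset.image_image, Finset.image_image]; rfl
      _ ≤ s := Finset.card_image_le.trans (hs D₀ hD₀)

/-- The Reynolds sum over `Sym_n × Sym_n` does not increase the numbers of rows and columns used.
[folklore] -/
theorem rows_cols_le_of_mem_support_reynolds (q : MvPolynomial (Fin n × Fin n) ℂ) {r s : ℕ}
    (hr : ∀ D ∈ q.support, (D.support.image Prod.fst).card ≤ r)
    (hs : ∀ D ∈ q.support, (D.support.image Prod.snd).card ≤ s)
    {D : (Fin n × Fin n) →₀ ℕ}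
    (hD : D ∈ (∑ g : Equiv.Perm (Fin n) × Equiv.Perm (Fin n),
      rename (fun ij : Fin n × Fin n => (g.1 ij.1, g.2 ij.2)) q).support) :
    (D.support.image Prod.fst).card ≤ r ∧ (D.support.image Prod.snd).card ≤ s := by
  classical
  obtain ⟨g, -, hg⟩ := Finset.mem_biUnion.1 (support_sum hD)
  exact rows_cols_le_of_mem_support_rename q g hr hs hg

/-- **The Reynolds sum over `Sym_n × Sym_n` is matrix-symmetric.** [folklore] -/
theorem rename_reynolds (q : MvPolynomial (Fin n × Fin n) ℂ) (σ τ : Equiv.Perm (Fin n)) :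
    rename (fun ij : Fin n × Fin n => (σ ij.1, τ ij.2))
        (∑ g : Equiv.Perm (Fin n) × Equiv.Perm (Fin n),
          rename (fun ij : Fin n × Fin n => (g.1 ij.1, g.2 ij.2)) q) =
      ∑ g : Equiv.Perm (Fin n) × Equiv.Perm (Fin n),
        rename (fun ij : Fin n × Fin n => (g.1 ij.1, g.2 ij.2)) q := by
  simp only [map_sum, rename_rename]
  refine Fintype.sum_equiv (Equiv.mulLeft (σ, τ)) _ _ fun g => ?_
  congr 1

/-- The Reynolds sum of a matrix-symmetric polynomial is `|Sym_n × Sym_n| • p`. [folklore] -/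
theorem reynolds_of_matrixSymmetric (p : MvPolynomial (Fin n × Fin n) ℂ)
    (hp : ∀ σ τ : Equiv.Perm (Fin n), rename (fun ij : Fin n × Fin n => (σ ij.1, τ ij.2)) p = p) :
    (∑ g : Equiv.Perm (Fin n) × Equiv.Perm (Fin n),
        rename (fun ij : Fin n × Fin n => (g.1 ij.1, g.2 ij.2)) p) =
      (Fintype.card (Equiv.Perm (Fin n) × Equiv.Perm (Fin n)) : ℂ) • p := by
  rw [Finset.sum_congr rfl fun g _ => hp g.1 g.2, Finset.sum_const, Finset.card_univ,
    ← Nat.cast_smul_eq_nsmul ℂ]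

/-! ### The passage -/

/-- **THE ONE-SORTED → TWO-SORTED PASSAGE WITH A VERTEX BUDGET.**  A MATRIX-symmetric polynomial in the
span of the directed looped homomorphism polynomials `dihom_{E,n}` of patterns `E` on `≤ m` vertices lies in
the span of the bipartite homomorphism polynomials `hom_{F,n}` of patterns with `≤ m` row vertices and
`≤ m` column vertices. [cite: DawarPagoSeppelt2025, Remark p. 17 and §8 p. 45] -/
theorem mem_span_homPoly_of_mem_span_diHom {m : ℕ} (p : MvPolynomial (Fin n × Fin n) ℂ)
    (hp : ∀ σ τ : Equiv.Perm (Fin n), rename (fun ij : Fin n × Fin n => (σ ij.1, τ ij.2)) p = p)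
    (hdi : p ∈ Submodule.span ℂ {q : MvPolynomial (Fin n × Fin n) ℂ | ∃ (a : ℕ) (E : Multiset (Fin a × Fin a)),
      a ≤ m ∧ q = ∑ h : Fin a → Fin n,
        (E.map fun e => (X (h e.1, h e.2) : MvPolynomial (Fin n × Fin n) ℂ)).prod}) :
    p ∈ Submodule.span ℂ {q : MvPolynomial (Fin n × Fin n) ℂ | ∃ (a b : ℕ) (F : Multiset (Fin a × Fin b)),
      a ≤ m ∧ b ≤ m ∧ q = homPoly F n ℂ} := by
  classical
  -- the Reynolds sum of every member of the directed span lies in the bipartite span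
  have key : ∀ q ∈ Submodule.span ℂ {q : MvPolynomial (Fin n × Fin n) ℂ |
      ∃ (a : ℕ) (E : Multiset (Fin a × Fin a)), a ≤ m ∧ q = ∑ h : Fin a → Fin n,
        (E.map fun e => (X (h e.1, h e.2) : MvPolynomial (Fin n × Fin n) ℂ)).prod},
      (∑ g : Equiv.Perm (Fin n) × Equiv.Perm (Fin n),
        rename (fun ij : Fin n × Fin n => (g.1 ij.1, g.2 ij.2)) q) ∈
      Submodule.span ℂ {q : MvPolynomial (Fin n × Fin n) ℂ | ∃ (a b : ℕ) (F : Multiset (Fin a × Fin b)),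
        a ≤ m ∧ b ≤ m ∧ q = homPoly F n ℂ} := by
    intro q hq
    refine Submodule.span_induction (p := fun q _ => (∑ g : Equiv.Perm (Fin n) × Equiv.Perm (Fin n),
        rename (fun ij : Fin n × Fin n => (g.1 ij.1, g.2 ij.2)) q) ∈
      Submodule.span ℂ {q : MvPolynomial (Fin n × Fin n) ℂ | ∃ (a b : ℕ) (F : Multiset (Fin a × Fin b)),
        a ≤ m ∧ b ≤ m ∧ q = homPoly F n ℂ}) ?_ (by simp) (fun x y _ _ hx hy => ?_)
      (fun c x _ hx => ?_) hq
    · rintro q ⟨a, E, ha, rfl⟩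
      have hrc : ∀ D ∈ (∑ g : Equiv.Perm (Fin n) × Equiv.Perm (Fin n),
          rename (fun ij : Fin n × Fin n => (g.1 ij.1, g.2 ij.2)) (∑ h : Fin a → Fin n,
            (E.map fun e => (X (h e.1, h e.2) : MvPolynomial (Fin n × Fin n) ℂ)).prod)).support,
          (D.support.image Prod.fst).card ≤ a ∧ (D.support.image Prod.snd).card ≤ a :=
        fun D hD => rows_cols_le_of_mem_support_reynolds (r := a) (s := a) _
          (fun D' hD' => (rows_cols_le_of_mem_support_diHom (n := n) E hD').1)
          (fun D' hD' => (rows_cols_le_of_mem_support_diHom (n := n) E hD').2) hD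
      refine Submodule.span_mono ?_ (mem_span_homPoly_of_rows_cols_le _ (rename_reynolds _)
        (fun D hD => (hrc D hD).1) (fun D hD => (hrc D hD).2))
      rintro q ⟨a', b', F, ha', hb', -, rfl⟩
      exact ⟨a', b', F, ha'.trans ha, hb'.trans ha, rfl⟩
    · simp only [map_add, Finset.sum_add_distrib]
      exact Submodule.add_mem _ hx hy
    · simp only [map_smul, ← Finset.smul_sum]
      exact Submodule.smul_mem _ _ hx
  have hG : (Fintype.card (Equiv.Perm (Fin n) × Equiv.Perm (Fin n)) : ℂ) ≠ 0 :=
    Nat.cast_ne_zero.2 Fintype.card_ne_zero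
  have h := key p hdi
  rw [reynolds_of_matrixSymmetric p hp] at h
  have := Submodule.smul_mem _ ((Fintype.card (Equiv.Perm (Fin n) × Equiv.Perm (Fin n)) : ℂ)⁻¹) h
  rwa [smul_smul, inv_mul_cancel₀ hG, one_smul] at this

/-- **Treewidth form (K1's currency).**  Under the same hypotheses `p` lies in the span of the `hom_{F,n}`
over bipartite patterns whose pattern graph has treewidth `≤ 2m - 1`. [folklore] -/
theorem mem_narrowSpan_of_mem_span_diHom {m : ℕ} (p : MvPolynomial (Fin n × Fin n) ℂ)
    (hp : ∀ σ τ : Equiv.Perm (Fin n), rename (fun ij : Fin n × Fin n => (σ ij.1, τ ij.2)) p = p)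
    (hdi : p ∈ Submodule.span ℂ {q : MvPolynomial (Fin n × Fin n) ℂ | ∃ (a : ℕ) (E : Multiset (Fin a × Fin a)),
      a ≤ m ∧ q = ∑ h : Fin a → Fin n,
        (E.map fun e => (X (h e.1, h e.2) : MvPolynomial (Fin n × Fin n) ℂ)).prod}) :
    p ∈ Submodule.span ℂ
      {q : MvPolynomial (Fin n × Fin n) ℂ | ∃ (a b : ℕ) (E : Multiset (Fin a × Fin b)),
        Literature.Combinatorics.SimpleGraph.treewidth
            (SimpleGraph.fromRel fun u v : Fin a ⊕ Fin b =>
              ∃ e ∈ E, u = Sum.inl e.1 ∧ v = Sum.inr e.2) ≤ 2 * m - 1 ∧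
          q = homPoly E n ℂ} := by
  refine Submodule.span_mono ?_ (mem_span_homPoly_of_mem_span_diHom p hp hdi)
  rintro q ⟨a, b, F, ha, hb, rfl⟩
  refine ⟨a, b, F, (Literature.Combinatorics.SimpleGraph.treewidth_le_card_sub_one _).trans ?_, rfl⟩
  simp only [Fintype.card_sum, Fintype.card_fin]
  omega

end TwoSortedPassage

end Summit.ValiantsHypothesis.ValiantsHypothesis.Theorems

end
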